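import Mathlib
import Summits.Ventures.HodgeRepro.Tier4.Line4.SublevelCount
import Summits.Ventures.HodgeRepro.Tier4.Line4.PoincareSummableOfDecay

/-!
# Tier4/Line4/SublevelCountGlue — display (8) from the sublevel count: `SublevelCount W S → PoincareOfDecay W S`

Blind re-derivation cell `pub-hodge-repro`, Tier 4 «prove the step» (README §9–§10), seat t4-L4-p2 (prover, LINE L4,
gen 4; C-L4-SUBLEVEL (K1), the glue half).  Tree path `lean/Summits/Ventures/HodgeRepro/Tier4/Line4/SublevelCountGlue.lean`.
One theorem, by name on t4-x2's `poincareSummable_of_decay'` (PoincareSummableOfDecay p700863) with `dinf := archDist W`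
(`archDist (ofInfPart z) = archDist z` is `rfl`): the displayed count `SublevelCount W S` gives the Poincaré clause of every
product test `finf ⊗ ffin` with `HasDecay3 W finf` and `IsFinFactor W ffin` — display (8) of Skeleton-v0.33 is then the
ONE display `SublevelCount`.

Nothing here says anything about the status of the Hodge conjecture for CM abelian varieties, which is NOT proved
(HC_CM is NOT proved by anyone in this repository).
-/

set_option autoImplicit false

noncomputable section

namespace Summit.Ventures.HodgeRepro.Tier4.Line4

open Summit.Ventures.HodgeRepro.Tier4.Common Summit.Ventures.HodgeRepro.Tier4.Line1
  Summit.Ventures.HodgeRepro.Tier4.Line1.RTF Summit.Ventures.HodgeRepro.Tier4.Line4.L1Class MeasureTheory NumberField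

variable {k : Type} [Field k] [NumberField k] (W : PlaneData k) [MeasurableSpace (GA W)] [BorelSpace (GA W)]

omit [BorelSpace (GA W)] in
/-- **Display (8) from the sublevel count**: `SublevelCount W S → PoincareOfDecay W S`
(`poincareSummable_of_decay'` at `dinf := archDist W`, `β := 3`). -/
theorem poincareOfDecay_of_sublevelCount (S : RTF.Setting (GA W)) (h : SublevelCount W S) :
    PoincareOfDecay W S := by
  intro finf ffin _ hdec hffin
  obtain ⟨C, hC⟩ := hdec
  exact poincareSummable_of_decay' W S (archDist W) (archDist_nonneg W) (fun _ => rfl) (by norm_num) hC hffin h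

end Summit.Ventures.HodgeRepro.Tier4.Line4

end
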